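import Mathlib
import Literature.Barriers.ValiantsHypothesis.AlgebraicNaturalProofs
import Literature.Computability.AlgebraicComplexity.ArithCircuitProofs
import Literature.Computability.AlgebraicComplexity.IMMInVPProofs
import Summits.ValiantsHypothesis.ValiantsHypothesis.Theorems.BarrierLeverPartitionMinorsHitByVPTwinFreeLift

/-!
# Route BarrierLever — item `PartitionMinorsHitByVP` (stmt-ValiantsHypothesis-19717):
# the TWIN-MATCHING CONTRACTION DOOR, part 1/2: the matrix engine and the common witness

Helper file (`--supports stmt-ValiantsHypothesis-19717`; cell valiant-natproofs, rung V4, 𝒟-side,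
prover seat val-np-p3 gen 3). Definition-free. Closes NO item.

Contract one coordinate pair `(a, c)`: row `U` goes to `U.erase a`, column `W` to `W.erase c`.
Two rows with the same contraction form an `a`-TWIN PAIR `{U, U ∪ {a}}`; the other rows are
singletons of their class. The twin-free lift of `…TwinFreeLift` (val-np-p6; the counterpart of the
TT reduction R2) handles the case of NO twins on either side. This file handles EQUAL TWIN COUNTS:
if the number of `a`-twin pairs among the rows equals the number of `c`-twin pairs among the
columns, and ONE polynomial `g` certifies both
* the CLASS layout `L♭` (one representative row per row class — the bottom `U ∌ a` when present —
  against one representative column per column class), and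
* the TWIN layout `L^tw` (the twin-top rows `U ∋ a` whose bottom is a row, against the twin-top
  columns),
then `f = g₀ · ((1 + x_a)(1 + y_c) + μ · x_a y_c)` (`g₀` = `g` with the monomials containing `x_a`
or `y_c` removed) certifies `(u, w)` for all but finitely many `μ`, at cost `L(f) ≤ L(g) + 7`,
`deg f ≤ deg g + 2`. PROOF: the layout matrix of `f` is `N_μ[i,j] = M[ρ i, ρ' j] · (1 + μ·[a ∈ u i]
[c ∈ w j])` with `M` the contracted matrix of `g`; after the unimodular operations «twin-top row −=
its bottom row», «twin-top column −= its bottom column» it becomes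
`[[M₁₁ + μE₁₁, μE₁₂], [μE₂₁, μM₂₂]]` in the block decomposition (representatives | twin tops), with
`M₁₁ = M[L♭]`, `M₂₂ = M[L^tw]`; so `det N_μ = μ^tw · q(μ)` with `q(0) = det M[L♭] · det M[L^tw] ≠ 0`
(`exists_det_fromBlocks_pert_ne_zero`, `exists_det_twinGadget_ne_zero`).

The index bookkeeping is supplied by the user as DATA: equivalences `erow ecol : κ₁ ⊕ κ₂ ≃ ι`
(representatives ⊕ twin tops) and the bottom maps `c₁ c₂ : κ₂ → κ₁`, with three hypotheses each
(bottom avoids the coordinate, top contains it, equal contractions). No injectivity hypothesis is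
needed (a bad choice of representatives only makes the hypotheses on `g` unsatisfiable). Taking
`κ₂` empty recovers the twin-free lift. In TNS / TT language (items 19126 / 19152) the same
computation with the `2 × 2` block `[[1, 1], [−μ, 1]] ⊕ K'` is a REDUCTION: a minimal
counterexample to `PrincipalMinorLayoutsNonsingular` has `tw_a(u) ≠ tw_c(w)` for all `a, c`.

* `exists_det_fromBlocks_pert_ne_zero` — `det [[M₁₁ + μE₁₁, μE₁₂], [E₂₁, M₂₂]] ≠ 0` for some
  `μ ≠ 0` when `det M₁₁ · det M₂₂ ≠ 0` (polynomial in `μ`, value at `0`).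
* `exists_det_twinGadget_ne_zero` — the matrix-level engine (any entry function, any index types).
* `coeff_twinGadget` — the layout matrix of `g₀ · ((1 + x_a)(1 + y_c) + μ x_a y_c)`.
* **`partitionMinor_hit_of_twinMatching`** — the door (degree-free bookkeeping; combine with
  `…StrataDoor.exists_smallCircuits_of_sized` to land in `SmallCircuits`).
* `exists_common_witness` — two certified layouts have a COMMON witness `g₁ + C t · g₂`
  (how the single `g` of the door is produced; cost additive).

WHAT THIS IS NOT: one reduction step; nothing on which layouts reduce to few good leaves (the
content of item 19717), on crux 14610 or on VP vs VNP.
-/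

set_option linter.dupNamespace false

namespace Summit.ValiantsHypothesis.ValiantsHypothesis.Theorems.BarrierLever.TwinMatching

open Finset Polynomial
open Literature.Barriers.ValiantsHypothesis Literature.Computability.AlgebraicComplexity
open Summit.ValiantsHypothesis.ValiantsHypothesis.Theorems.BarrierLever.ProductStateSums
  (castAdd_ne_natAdd partitionExpo_apply_castAdd partitionExpo_apply_natAdd)
open Summit.ValiantsHypothesis.ValiantsHypothesis.Theorems.BarrierLever.StrataDoor
  (coeff_killVars complexity_killVars_le totalDegree_killVars_le coeff_mul_one_add_X_of_free
    partitionExpo_erase_erase)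

/-! ## 1. The matrix engine -/

section Engine

variable {κ₁ κ₂ : Type*} [Fintype κ₁] [DecidableEq κ₁] [Fintype κ₂] [DecidableEq κ₂]

/-- **Perturbed block-triangular determinant.** If `det M₁₁ ≠ 0` and `det M₂₂ ≠ 0` then
`det [[M₁₁ + μE₁₁, μE₁₂], [E₂₁, M₂₂]] ≠ 0` for some `μ ≠ 0` (it is a polynomial in `μ` whose
value at `μ = 0` is `det M₁₁ · det M₂₂`). -/
theorem exists_det_fromBlocks_pert_ne_zero
    (M₁₁ E₁₁ : Matrix κ₁ κ₁ ℂ) (E₁₂ : Matrix κ₁ κ₂ ℂ) (E₂₁ : Matrix κ₂ κ₁ ℂ)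
    (M₂₂ : Matrix κ₂ κ₂ ℂ) (h₁ : M₁₁.det ≠ 0) (h₂ : M₂₂.det ≠ 0) :
    ∃ μ : ℂ, μ ≠ 0 ∧
      (Matrix.fromBlocks (M₁₁ + μ • E₁₁) (μ • E₁₂) E₂₁ M₂₂).det ≠ 0 := by
  classical
  set Q : Matrix (κ₁ ⊕ κ₂) (κ₁ ⊕ κ₂) ℂ[X] :=
    Matrix.fromBlocks (Matrix.of fun i j => C (M₁₁ i j) + X * C (E₁₁ i j))
      (Matrix.of fun i j => X * C (E₁₂ i j)) (Matrix.of fun i j => C (E₂₁ i j))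
      (Matrix.of fun i j => C (M₂₂ i j)) with hQ
  have hev : ∀ μ : ℂ, Q.map (Polynomial.eval μ) =
      Matrix.fromBlocks (M₁₁ + μ • E₁₁) (μ • E₁₂) E₂₁ M₂₂ := by
    intro μ
    ext i j
    rcases i with i | i <;> rcases j with j | j
    · simp only [hQ, Matrix.map_apply, Matrix.fromBlocks_apply₁₁, Matrix.of_apply, eval_add,
        eval_mul, eval_C, eval_X, Matrix.add_apply, Matrix.smul_apply, smul_eq_mul]
    · simp only [hQ, Matrix.map_apply, Matrix.fromBlocks_apply₁₂, Matrix.of_apply,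
        eval_mul, eval_C, eval_X, Matrix.smul_apply, smul_eq_mul]
    · simp only [hQ, Matrix.map_apply, Matrix.fromBlocks_apply₂₁, Matrix.of_apply, eval_C]
    · simp only [hQ, Matrix.map_apply, Matrix.fromBlocks_apply₂₂, Matrix.of_apply, eval_C]
  have hdet_ev : ∀ μ : ℂ, (Q.map (Polynomial.eval μ)).det = (Q.det).eval μ := fun μ =>
    (RingHom.map_det (Polynomial.evalRingHom μ) Q).symm
  have h0 : (Q.map (Polynomial.eval 0)).det ≠ 0 := by
    rw [hev 0, zero_smul, zero_smul, add_zero, Matrix.det_fromBlocks_zero₁₂]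
    exact mul_ne_zero h₁ h₂
  have hQne : Q.det ≠ 0 := by
    intro hz
    apply h0
    rw [hdet_ev, hz, eval_zero]
  obtain ⟨μ, hμ⟩ := Infinite.exists_notMem_finset (Q.det.roots.toFinset ∪ {0})
  rw [Finset.mem_union, Finset.mem_singleton, Multiset.mem_toFinset, not_or] at hμ
  refine ⟨μ, hμ.2, ?_⟩
  rw [← hev μ, hdet_ev]
  intro hz
  exact hμ.1 ((Polynomial.mem_roots hQne).mpr hz)

/-- **The twin-matching engine (matrix level).** Rows and columns of an `ι × ι` matrix are split as
representatives `κ₁` and twin tops `κ₂` (`erow`, `ecol`), each twin top `k` has a bottom `c₁ k`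
(resp. `c₂ k`) among the representatives with the same contracted label `ρ` (resp. `ρ'`), the top
carries the mark `top` (resp. `top'`) and the bottom does not. If the entry function `Mf` is
nonsingular on representatives × representatives and on twin tops × twin tops, then for some `μ`
the matrix `Mf (ρ i) (ρ' j) · (1 + μ·[top i][top' j])` is nonsingular. -/
theorem exists_det_twinGadget_ne_zero {ι α β : Type*} [Fintype ι] [DecidableEq ι]
    (Mf : α → β → ℂ) (ρ : ι → α) (ρ' : ι → β) (top top' : ι → Prop)
    [DecidablePred top] [DecidablePred top']
    (erow ecol : κ₁ ⊕ κ₂ ≃ ι) (c₁ c₂ : κ₂ → κ₁)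
    (hr₁ : ∀ k, ¬ top (erow (Sum.inl (c₁ k)))) (hr₂ : ∀ k, top (erow (Sum.inr k)))
    (hr₃ : ∀ k, ρ (erow (Sum.inr k)) = ρ (erow (Sum.inl (c₁ k))))
    (hc₁ : ∀ k, ¬ top' (ecol (Sum.inl (c₂ k)))) (hc₂ : ∀ k, top' (ecol (Sum.inr k)))
    (hc₃ : ∀ k, ρ' (ecol (Sum.inr k)) = ρ' (ecol (Sum.inl (c₂ k))))
    (H₁ : (Matrix.of fun k k' : κ₁ =>
      Mf (ρ (erow (Sum.inl k))) (ρ' (ecol (Sum.inl k')))).det ≠ 0)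
    (H₂ : (Matrix.of fun k k' : κ₂ =>
      Mf (ρ (erow (Sum.inr k))) (ρ' (ecol (Sum.inr k')))).det ≠ 0) :
    ∃ μ : ℂ, (Matrix.of fun i j : ι =>
      Mf (ρ i) (ρ' j) * (if top i ∧ top' j then 1 + μ else 1)).det ≠ 0 := by
  classical
  -- the blocks of the normal form
  set M₁₁ : Matrix κ₁ κ₁ ℂ := Matrix.of fun k k' : κ₁ =>
    Mf (ρ (erow (Sum.inl k))) (ρ' (ecol (Sum.inl k'))) with hM₁₁
  set E₁₁ : Matrix κ₁ κ₁ ℂ := Matrix.of fun k k' : κ₁ =>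
    if top (erow (Sum.inl k)) ∧ top' (ecol (Sum.inl k')) then
      Mf (ρ (erow (Sum.inl k))) (ρ' (ecol (Sum.inl k'))) else 0 with hE₁₁
  set E₁₂ : Matrix κ₁ κ₂ ℂ := Matrix.of fun (k : κ₁) (k' : κ₂) =>
    if top (erow (Sum.inl k)) then Mf (ρ (erow (Sum.inl k))) (ρ' (ecol (Sum.inr k'))) else 0
    with hE₁₂
  set E₂₁ : Matrix κ₂ κ₁ ℂ := Matrix.of fun (k : κ₂) (k' : κ₁) =>
    if top' (ecol (Sum.inl k')) then Mf (ρ (erow (Sum.inr k))) (ρ' (ecol (Sum.inl k'))) else 0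
    with hE₂₁
  set M₂₂ : Matrix κ₂ κ₂ ℂ := Matrix.of fun k k' : κ₂ =>
    Mf (ρ (erow (Sum.inr k))) (ρ' (ecol (Sum.inr k'))) with hM₂₂
  obtain ⟨μ, hμ0, hμ⟩ := exists_det_fromBlocks_pert_ne_zero M₁₁ E₁₁ E₁₂ E₂₁ M₂₂ H₁ H₂
  refine ⟨μ, ?_⟩
  set N : Matrix ι ι ℂ := Matrix.of fun i j : ι =>
    Mf (ρ i) (ρ' j) * (if top i ∧ top' j then 1 + μ else 1) with hN
  -- reindex rows by `erow`, columns by `ecol`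
  set N' : Matrix (κ₁ ⊕ κ₂) (κ₁ ⊕ κ₂) ℂ := N.submatrix erow ecol with hN'
  have hdet : N'.det ≠ 0 → N.det ≠ 0 := by
    intro h hz
    apply h
    have hNN : N' = (N.submatrix id ⇑(erow.symm.trans ecol)).submatrix erow erow := by
      ext i j
      simp [hN', Matrix.submatrix_apply]
    rw [hNN, Matrix.det_submatrix_equiv_self, Matrix.det_permute', hz, mul_zero]
  apply hdet
  -- the unimodular row / column operations
  set P : Matrix κ₂ κ₁ ℂ := Matrix.of fun (k₂ : κ₂) (k : κ₁) => if k = c₁ k₂ then (1 : ℂ) else 0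
    with hP
  set Qm : Matrix κ₁ κ₂ ℂ := Matrix.of fun (k : κ₁) (k₂ : κ₂) => if k = c₂ k₂ then (1 : ℂ) else 0
    with hQm
  have hPmul₁ : ∀ (Z : Matrix κ₁ κ₁ ℂ) (k₂ : κ₂) (j : κ₁), (P * Z) k₂ j = Z (c₁ k₂) j := by
    intro Z k₂ j
    simp [Matrix.mul_apply, hP, ite_mul, Finset.sum_ite_eq']
  have hPmul₂ : ∀ (Z : Matrix κ₁ κ₂ ℂ) (k₂ : κ₂) (j : κ₂), (P * Z) k₂ j = Z (c₁ k₂) j := by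
    intro Z k₂ j
    simp [Matrix.mul_apply, hP, ite_mul, Finset.sum_ite_eq']
  have hmulQ₁ : ∀ (Z : Matrix κ₁ κ₁ ℂ) (i : κ₁) (k₂ : κ₂), (Z * Qm) i k₂ = Z i (c₂ k₂) := by
    intro Z i k₂
    simp [Matrix.mul_apply, hQm, mul_ite, Finset.sum_ite_eq']
  have hmulQ₂ : ∀ (Z : Matrix κ₂ κ₁ ℂ) (i : κ₂) (k₂ : κ₂), (Z * Qm) i k₂ = Z i (c₂ k₂) := by
    intro Z i k₂
    simp [Matrix.mul_apply, hQm, mul_ite, Finset.sum_ite_eq']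
  -- block form of N'
  set A₁₁ : Matrix κ₁ κ₁ ℂ := Matrix.of fun k k' => N (erow (Sum.inl k)) (ecol (Sum.inl k'))
    with hA₁₁
  set A₁₂ : Matrix κ₁ κ₂ ℂ := Matrix.of fun k k' => N (erow (Sum.inl k)) (ecol (Sum.inr k'))
    with hA₁₂
  set A₂₁ : Matrix κ₂ κ₁ ℂ := Matrix.of fun k k' => N (erow (Sum.inr k)) (ecol (Sum.inl k'))
    with hA₂₁
  set A₂₂ : Matrix κ₂ κ₂ ℂ := Matrix.of fun k k' => N (erow (Sum.inr k)) (ecol (Sum.inr k'))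
    with hA₂₂
  have hN'b : N' = Matrix.fromBlocks A₁₁ A₁₂ A₂₁ A₂₂ := by
    ext (i | i) (j | j) <;> rfl
  have key : Matrix.fromBlocks 1 0 (-P) 1 * N' * Matrix.fromBlocks 1 (-Qm) 0 1 =
      Matrix.fromBlocks (M₁₁ + μ • E₁₁) (μ • E₁₂) (μ • E₂₁) (μ • M₂₂) := by
    rw [hN'b, Matrix.fromBlocks_multiply, Matrix.fromBlocks_multiply]
    simp only [Matrix.one_mul, Matrix.zero_mul, Matrix.mul_one, Matrix.mul_zero, add_zero,
      Matrix.neg_mul, Matrix.mul_neg]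
    ext (k | k) (k' | k')
    · -- block (1,1)
      simp only [Matrix.fromBlocks_apply₁₁, hA₁₁, Matrix.of_apply, hN, hM₁₁, hE₁₁,
        Matrix.add_apply, Matrix.smul_apply, smul_eq_mul]
      split_ifs <;> ring
    · -- block (1,2)
      simp only [Matrix.fromBlocks_apply₁₂, Matrix.add_apply, Matrix.neg_apply, hmulQ₁,
        hA₁₁, hA₁₂, Matrix.of_apply, hN, hE₁₂, Matrix.smul_apply, smul_eq_mul]
      rw [hc₃ k']
      have h1 := hc₁ k'
      have h2 := hc₂ k'
      by_cases ht : top (erow (Sum.inl k))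
      · simp [ht, h1, h2]; ring
      · simp [ht, h1, h2]
    · -- block (2,1)
      simp only [Matrix.fromBlocks_apply₂₁, Matrix.add_apply, Matrix.neg_apply, hPmul₁,
        hA₁₁, hA₂₁, Matrix.of_apply, hN, hE₂₁, Matrix.smul_apply, smul_eq_mul]
      rw [hr₃ k]
      have h1 := hr₁ k
      have h2 := hr₂ k
      by_cases ht : top' (ecol (Sum.inl k'))
      · simp [ht, h1, h2]; ring
      · simp [ht, h1, h2]
    · -- block (2,2)
      simp only [Matrix.fromBlocks_apply₂₂, Matrix.add_apply, Matrix.neg_apply, Matrix.add_mul,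
        Matrix.neg_mul, hmulQ₂, hPmul₁, hPmul₂,
        hA₁₁, hA₁₂, hA₂₁, hA₂₂, Matrix.of_apply, hN, hM₂₂, Matrix.smul_apply, smul_eq_mul]
      rw [hr₃ k, hc₃ k']
      have h1 := hr₁ k
      have h2 := hr₂ k
      have h3 := hc₁ k'
      have h4 := hc₂ k'
      simp [h1, h2, h3, h4]
      ring
  -- determinants
  have hR : (Matrix.fromBlocks (1 : Matrix κ₁ κ₁ ℂ) 0 (-P) (1 : Matrix κ₂ κ₂ ℂ)).det = 1 := by
    rw [Matrix.det_fromBlocks_zero₁₂, Matrix.det_one, Matrix.det_one, mul_one]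
  have hC : (Matrix.fromBlocks (1 : Matrix κ₁ κ₁ ℂ) (-Qm) 0 (1 : Matrix κ₂ κ₂ ℂ)).det = 1 := by
    rw [Matrix.det_fromBlocks_zero₂₁, Matrix.det_one, Matrix.det_one, mul_one]
  have hfac : Matrix.fromBlocks (M₁₁ + μ • E₁₁) (μ • E₁₂) (μ • E₂₁) (μ • M₂₂) =
      Matrix.fromBlocks 1 0 0 (μ • (1 : Matrix κ₂ κ₂ ℂ)) *
        Matrix.fromBlocks (M₁₁ + μ • E₁₁) (μ • E₁₂) E₂₁ M₂₂ := by
    rw [Matrix.fromBlocks_multiply]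
    simp [Matrix.smul_mul]
  have hdet3 : (Matrix.fromBlocks (M₁₁ + μ • E₁₁) (μ • E₁₂) (μ • E₂₁) (μ • M₂₂)).det =
      μ ^ Fintype.card κ₂ * (Matrix.fromBlocks (M₁₁ + μ • E₁₁) (μ • E₁₂) E₂₁ M₂₂).det := by
    rw [hfac, Matrix.det_mul, Matrix.det_fromBlocks_zero₁₂, Matrix.det_one, one_mul,
      Matrix.det_smul, Matrix.det_one, mul_one]
  intro hz
  have hk := congrArg Matrix.det key
  rw [Matrix.det_mul, Matrix.det_mul, hR, hC, one_mul, mul_one, hdet3, hz] at hk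
  exact mul_ne_zero (pow_ne_zero _ hμ0) hμ hk.symm

end Engine

/-! ## 2. A common witness for two certified layouts -/

section Common

variable {σ : Type*}

/-- **Common witness.** If `g₁` has a nonsingular coefficient matrix on one family of exponents and
`g₂` on another, then `g₁ + C t · g₂` is nonsingular on BOTH for some `t` (all but finitely many:
`det (A₁ + t B₁)` is a polynomial with constant term `det A₁ ≠ 0`, and `det (A₂ + t B₂) =
t^r · det (B₂ + t⁻¹ A₂)`). -/
theorem exists_common_witness {ι₁ ι₂ : Type*} [Fintype ι₁] [DecidableEq ι₁] [Fintype ι₂]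
    [DecidableEq ι₂] (m₁ : ι₁ → ι₁ → (σ →₀ ℕ)) (m₂ : ι₂ → ι₂ → (σ →₀ ℕ))
    (g₁ g₂ : MvPolynomial σ ℂ)
    (h₁ : (Matrix.of fun i j : ι₁ => MvPolynomial.coeff (m₁ i j) g₁).det ≠ 0)
    (h₂ : (Matrix.of fun i j : ι₂ => MvPolynomial.coeff (m₂ i j) g₂).det ≠ 0) :
    ∃ t : ℂ, (Matrix.of fun i j : ι₁ =>
        MvPolynomial.coeff (m₁ i j) (g₁ + MvPolynomial.C t * g₂)).det ≠ 0 ∧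
      (Matrix.of fun i j : ι₂ =>
        MvPolynomial.coeff (m₂ i j) (g₁ + MvPolynomial.C t * g₂)).det ≠ 0 := by
  classical
  set A₁ : Matrix ι₁ ι₁ ℂ := Matrix.of fun i j => MvPolynomial.coeff (m₁ i j) g₁ with hA₁
  set B₁ : Matrix ι₁ ι₁ ℂ := Matrix.of fun i j => MvPolynomial.coeff (m₁ i j) g₂ with hB₁
  set A₂ : Matrix ι₂ ι₂ ℂ := Matrix.of fun i j => MvPolynomial.coeff (m₂ i j) g₁ with hA₂
  set B₂ : Matrix ι₂ ι₂ ℂ := Matrix.of fun i j => MvPolynomial.coeff (m₂ i j) g₂ with hB₂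
  have hN₁ : ∀ t : ℂ, (Matrix.of fun i j : ι₁ =>
      MvPolynomial.coeff (m₁ i j) (g₁ + MvPolynomial.C t * g₂)) = A₁ + t • B₁ := by
    intro t
    ext i j
    simp only [Matrix.of_apply, MvPolynomial.coeff_add, MvPolynomial.coeff_C_mul, Matrix.add_apply,
      Matrix.smul_apply, smul_eq_mul, hA₁, hB₁]
  have hN₂ : ∀ t : ℂ, (Matrix.of fun i j : ι₂ =>
      MvPolynomial.coeff (m₂ i j) (g₁ + MvPolynomial.C t * g₂)) = A₂ + t • B₂ := by
    intro t
    ext i j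
    simp only [Matrix.of_apply, MvPolynomial.coeff_add, MvPolynomial.coeff_C_mul, Matrix.add_apply,
      Matrix.smul_apply, smul_eq_mul, hA₂, hB₂]
  -- two polynomial matrices
  set Q₁ : Matrix ι₁ ι₁ ℂ[X] := Matrix.of fun i j => C (A₁ i j) + X * C (B₁ i j) with hQ₁
  set Q₂ : Matrix ι₂ ι₂ ℂ[X] := Matrix.of fun i j => C (B₂ i j) + X * C (A₂ i j) with hQ₂
  have hev₁ : ∀ t : ℂ, Q₁.map (Polynomial.eval t) = A₁ + t • B₁ := by
    intro t; ext i j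
    simp only [hQ₁, Matrix.map_apply, Matrix.of_apply, eval_add, eval_mul, eval_C, eval_X,
      Matrix.add_apply, Matrix.smul_apply, smul_eq_mul]
  have hev₂ : ∀ t : ℂ, Q₂.map (Polynomial.eval t) = B₂ + t • A₂ := by
    intro t; ext i j
    simp only [hQ₂, Matrix.map_apply, Matrix.of_apply, eval_add, eval_mul, eval_C, eval_X,
      Matrix.add_apply, Matrix.smul_apply, smul_eq_mul]
  have hdet₁ : ∀ t : ℂ, (Q₁.map (Polynomial.eval t)).det = (Q₁.det).eval t := fun t =>
    (RingHom.map_det (Polynomial.evalRingHom t) Q₁).symm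
  have hdet₂ : ∀ t : ℂ, (Q₂.map (Polynomial.eval t)).det = (Q₂.det).eval t := fun t =>
    (RingHom.map_det (Polynomial.evalRingHom t) Q₂).symm
  have hQ₁ne : Q₁.det ≠ 0 := by
    intro hz
    have h0 := hdet₁ 0
    rw [hev₁ 0, zero_smul, add_zero, hz, eval_zero] at h0
    exact h₁ h0
  have hQ₂ne : Q₂.det ≠ 0 := by
    intro hz
    have h0 := hdet₂ 0
    rw [hev₂ 0, zero_smul, add_zero, hz, eval_zero] at h0
    exact h₂ h0
  obtain ⟨t, ht⟩ := Infinite.exists_notMem_finset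
    (Q₁.det.roots.toFinset ∪ {0} ∪ Q₂.det.roots.toFinset.image (fun s : ℂ => s⁻¹))
  simp only [Finset.mem_union, Finset.mem_singleton, Multiset.mem_toFinset, Finset.mem_image,
    not_or, not_exists, not_and] at ht
  obtain ⟨⟨ht₁, ht0⟩, ht₂⟩ := ht
  refine ⟨t, ?_, ?_⟩
  · rw [hN₁, ← hev₁, hdet₁]
    intro hz
    exact ht₁ ((Polynomial.mem_roots hQ₁ne).mpr hz)
  · rw [hN₂]
    have hfac : A₂ + t • B₂ = t • (B₂ + t⁻¹ • A₂) := by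
      rw [smul_add, smul_smul, mul_inv_cancel₀ ht0, one_smul, add_comm]
    rw [hfac, Matrix.det_smul, ← hev₂, hdet₂]
    refine mul_ne_zero (pow_ne_zero _ ht0) fun hz => ?_
    have hroot : t⁻¹ ∈ Q₂.det.roots := (Polynomial.mem_roots hQ₂ne).mpr hz
    exact ht₂ t⁻¹ hroot (inv_inv t)

/-- Cost of the common witness: `L(g₁ + C t · g₂) ≤ L(g₁) + L(g₂) + 2`. -/
theorem complexity_add_C_mul_le {n : ℕ} (g₁ g₂ : MvPolynomial (Fin n) ℂ) (t : ℂ) :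
    complexity (g₁ + MvPolynomial.C t * g₂) ≤ complexity g₁ + complexity g₂ + 2 := by
  calc complexity (g₁ + MvPolynomial.C t * g₂)
      ≤ complexity g₁ + complexity (MvPolynomial.C t * g₂) + 1 := complexity_add_le_holds _ _
    _ ≤ complexity g₁ + (complexity (MvPolynomial.C t : MvPolynomial (Fin n) ℂ) +
          complexity g₂ + 1) + 1 := by
        gcongr
        exact complexity_mul_le_holds _ _
    _ = complexity g₁ + complexity g₂ + 2 := by rw [complexity_C_holds]; ring

/-- Degree of the common witness: `deg (g₁ + C t · g₂) ≤ max (deg g₁) (deg g₂)`. -/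
theorem totalDegree_add_C_mul_le (g₁ g₂ : MvPolynomial σ ℂ) (t : ℂ) :
    (g₁ + MvPolynomial.C t * g₂).totalDegree ≤ max g₁.totalDegree g₂.totalDegree := by
  refine (MvPolynomial.totalDegree_add _ _).trans (max_le_max le_rfl ?_)
  exact (MvPolynomial.totalDegree_mul _ _).trans (by rw [MvPolynomial.totalDegree_C, zero_add])

end Common

end Summit.ValiantsHypothesis.ValiantsHypothesis.Theorems.BarrierLever.TwinMatching
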